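import Summits.Ventures.CertifiedManyBodySolver.Downfold.TPrimePinnedPairRow
import Summits.Ventures.CertifiedManyBodySolver.Rows.CorrWindowStationarityRow
import Literature.MathematicalPhysics.QuantumLattice.HubbardTTPrimeSourcedCutRows
import Literature.MathematicalPhysics.QuantumLattice.BoxDualCovarianceCombination
import HarnessLib

/-!
# The PINNED t′-PAIR shape FROM TWO WINDOW IDENTITIES with SHARED equation-of-motion words:
# `SquareTTPrimePinnedPairRowT.of_windowIdentities` (cell `pub/hubbard-obs` × `pub/hubbard-downfold`, D-0154 (1)(C) COVERAGE La214;
# seat `hubbard-cov-la214-unc-2`, lineage desk; zero compute)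

HONEST FRAMING: soundness PLUMBING between two objects already in the tree — the state-level pinned-pair SHAPE
`SquareTTPrimePinnedPairRowT` (`Downfold/TPrimePinnedPairRow.lean`, whose `.bundle/.bundleExt/.bundle_vertex/.bundle_interior` turn a pair
node‴ into every t′-bundle claim node of the La214 station plans) and the Literature certificate-soundness theorem
`IsTorusLimitOf.re_sum_expect_d4_ge_of_window_certificate_TT'_ineq` (Wang et al. / Han: ONE identity in a window algebra ⇒ an orbit-mean
row in every torus-limit ground state). Nothing is asserted: no `def`, no named fact, no `sorry`, no number; no claim node is discharged
here (that needs the certificate exporter + the kernel evaluation of two identities — «tier P»); CONTROL / CALIBRATION wording class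
(xx1); no node of record, tier, word or registry row changes; no summit statement is proved by this file.

WHY. A pair node‴ `SquareTTPrimePinnedPairRowT U n sA sB cA cB flA flB βA κA κA' βB κB κB' X` (hubbard-cov-la214-unc-2 g5, p661405;
the La214 nodes p662438/p663756, the LSCO nodes p663521) is a CLAIM about states: two functionals `E₀, E₁` with (E) `E₀ω + s·E₁ω = 0` and
the two vertex rows (V_A), (V_B) for every torus-limit ground state `ω` at every hopping `s ∈ [sA, sB]`. It is what two SDP vertex
certificates solved with PINNED (shared) equation-of-motion multipliers establish. `Rows/CorrWindowStationarityRow.lean` (hubbard-obs-p2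
g22) typed (E) as a theorem and named the present file as the next brick: «a future kernel form of the pair shape (two exported vertex
certificates ⇒ the pair row) takes (E) from here and (V_A), (V_B) … with the eom words moved into the objective». THIS FILE IS THAT
PASSAGE, at the level of window IDENTITIES (the hypothesis `hcert` of every soundness theorem of the tree):

* §1 algebra: `H^{(1,c,U)}_{Λ'} = H^{(1,0,U)}_{Λ'} + c·T′_{Λ'}` (`localHamiltonian_tPrime_split`, from `hubbardTTPrimeFermionInteraction_taylor`)
  and the induced split of the eom family `Σ_k [H^{(1,c,U)}_{Λ'}, ΓB_k] = Σ_k [H^{(1,0,U)}_{Λ'}, ΓB_k] + c·Σ_k [T′_{Λ'}, ΓB_k]`;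
* §2 linearity of the rotated local functionals `T ↦ Re (ω∘γ)_{Λ'}(T)`;
* §3 **(V) ONE PINNED VERTEX** (`pinnedVertexRow_of_windowIdentity`): a window identity ISSUED AT HOPPING `sv` (the tree's `hcert`
  shape verbatim: objective `Xv`, constant `c`, density rows, a CAP row `κ (cap·1 − ΓE_Φ^{(1,sv,U)})`, a CUT row `κ' (ΓE_Φ^{(1,sv,U)} − fl·1)`,
  Gram / eom on words `B_k` / affine-`D₄` / charged / anti-Hermitian / residual families) read in a torus-limit ground state AT HOPPING `s`:
  `(c − Σ‖a‖ + (Σμ)(n/2 − ν)) + κ(cap − e + (s − sv)K₂ω) + κ'(e − (s − sv)K₂ω − fl) + (E₀ω + sv·E₁ω) ≤ |S|⁻¹Σ_γ Re (ω∘γ)_{Λ'}(Xv)`.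
  PROOF (hubbard-obs-p2's recipe, route «κ := 0»): the Literature theorem at the STATE's hopping `s` with energy multiplier `0`, an EMPTY
  eom family and the objective `Xv − (cap row) − (cut row) − (eom family at sv)` (the identity rearranged, no operator-level transport);
  then `Re (ω∘γ)(ΓE_Φ^{(1,sv,U)}) = e_{Φ(1,sv,U)}(ω) = e₀(1,s,U,n) + (sv − s)·K₂ω` (`IsTorusLimitOf.re_expect_d4Emb_meanEnergyObs`,
  `meanEnergy_hubbardTTPrime_affine`, `IsTorusLimitOf.meanEnergy_hubbardTTPrime_eq_energyDensityTT'`) and the eom orbit mean splits by §1;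
* §4 **(E)** (`pinnedStationarity`): `E₀ω + s·E₁ω = 0` for torus-limit ground states at hopping `s` — the orbit mean of
  `Re ω([H^{(1,s,U)}_{Λ'}, Γ(Σ_k B_k)])`, zero by `CARPolyWindow.orbitMean_re_commutator_eq_zero`;
* §5 **THE PAIR** (`SquareTTPrimePinnedPairRowT.of_windowIdentities`): two such identities at `sA`, `sB` in `𝔄_{Λ₇}` (`Λ₇ = box 2 7`, `S = D₄`)
  with objectives `X sA`, `X sB` and THE SAME eom words `B_k` ⇒ `SquareTTPrimePinnedPairRowT U n sA sB capA capB flA flB βA κA κA' βB κB κB' X`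
  for all rational `β_v ≤ c_v − Σ‖a_v‖ + (Σμ_v)(n/2 − ν_v)`. No sign condition on the `κ`'s is needed for the shape (the bundle law asks
  for them downstream).

So: PAIR NODE‴ ⇐ two vertex identities with a shared eom word list. With the syntactic kernel form of hubbard-obs-p2
(`Rows/CorrWindowCertKernelForm.lean`: an identity from term lists + `lowerConst (normalize residual)`) the two identities become kernel
computations; the pinning («pinfold») clause is then SYNTACTIC (the same `EB` list in both residuals). A relative of the tree's single-anchor
TRANSPORT (`HubbardTTPrimeWindowCertificateAnchorTransport{,D4}`: one certificate moved to a target with the conjugate charges explicit);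
here nothing is priced — the two vertices' `K₂` and eom terms are left symbolic for the covariance-box law of `TPrimePinnedPairRow` §C.
WHAT THIS IS NOT: a soundness theorem for the reduced program beyond the Literature theorem; an exporter; a number. References: D. P. Bertsekas, *Nonlinear Programming*, 2nd ed. (1999), Prop. 5.1.3
[Bertsekas1999NonlinearProgramming]; S. Boyd, L. Vandenberghe, *Convex Optimization* (2004) §5.9 [BoydVandenberghe2004]; J. Wang et al.,
PRX 14 (2024) 031006 §III [WangEtAl2024]; X. Han, arXiv:2006.06002 §3 [Han2020Bootstrap]; H. Xu et al., Science 384 (2024) eadh7691,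
eq. (1) [XuEtAl2024]; T. Koma, H. Tasaki, J. Stat. Phys. 76 (1994) 745 §1 (conjugate observables of linear couplings) [KomaTasaki1994].
-/

noncomputable section

namespace Summit.Ventures.CertifiedManyBodySolver.Downfold

open Literature.MathematicalPhysics.QuantumLattice
open Matrix HubbardWave0 Literature.Probability.LatticeModels ThermodynamicLimit Filter Topology
open Literature.MathematicalPhysics.QuantumManyBody.StateRelaxation
open Summit.Ventures.CertifiedManyBodySolver.Observables
open scoped BigOperators ComplexOrder

/-! ## §1  Algebra: the `t′`-split of the window Hamiltonian and of the equation-of-motion family -/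

section Split

variable {Λ Λ' : Finset (Site 2)}

/-- `H^{(1,c,U)}_{Λ'} = H^{(1,0,U)}_{Λ'} + c·T′_{Λ'}` with `T′_{Λ'} = H^{(0,1,0)}_{Λ'}` the unit diagonal-hopping window Hamiltonian
(the `t–t'–U` interaction is linear in the couplings, `hubbardTTPrimeFermionInteraction_taylor`). [cite: XuEtAl2024, eq. (1)] -/
theorem localHamiltonian_tPrime_split (c U : ℝ) (Λ' : Finset (Site 2)) :
    (hubbardTTPrimeFermionInteraction 1 c U).localHamiltonian Λ' =
      (hubbardTTPrimeFermionInteraction 1 0 U).localHamiltonian Λ' +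
        ((c : ℝ) : ℂ) • (hubbardTTPrimeFermionInteraction 0 1 0).localHamiltonian Λ' := by
  have h := FermionInteraction.localHamiltonian_of_add_smul_smul
    (Ψ := hubbardTTPrimeFermionInteraction 1 c U) (Ψ₀ := hubbardTTPrimeFermionInteraction 1 0 U)
    (Ψ₁ := hubbardTTPrimeFermionInteraction 0 1 0) (Ψ₂ := hubbardTTPrimeFermionInteraction 0 0 1)
    (c₁ := ((c - 0 : ℝ) : ℂ)) (c₂ := ((U - U : ℝ) : ℂ))
    (fun X => hubbardTTPrimeFermionInteraction_taylor 1 c U 0 U X) Λ'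
  rw [h, sub_zero, sub_self, Complex.ofReal_zero, zero_smul, add_zero]

/-- The equation-of-motion family splits accordingly:
`Σ_k [H^{(1,c,U)}_{Λ'}, ΓB_k] = Σ_k [H^{(1,0,U)}_{Λ'}, ΓB_k] + c·Σ_k [T′_{Λ'}, ΓB_k]`. [cite: Han2020Bootstrap, §3] -/
theorem eom_tPrime_split (c U : ℝ) (hΛ : Λ ⊆ Λ') {κ' : Type*} (s : Finset κ') (B : κ' → FermionOp Λ) :
    ∑ k ∈ s, ((hubbardTTPrimeFermionInteraction 1 c U).localHamiltonian Λ' * fermionEmbed (PolySite.incl hΛ) (B k) -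
        fermionEmbed (PolySite.incl hΛ) (B k) * (hubbardTTPrimeFermionInteraction 1 c U).localHamiltonian Λ') =
      ∑ k ∈ s, ((hubbardTTPrimeFermionInteraction 1 0 U).localHamiltonian Λ' * fermionEmbed (PolySite.incl hΛ) (B k) -
          fermionEmbed (PolySite.incl hΛ) (B k) * (hubbardTTPrimeFermionInteraction 1 0 U).localHamiltonian Λ') +
        ((c : ℝ) : ℂ) • ∑ k ∈ s, ((hubbardTTPrimeFermionInteraction 0 1 0).localHamiltonian Λ' * fermionEmbed (PolySite.incl hΛ) (B k) -
          fermionEmbed (PolySite.incl hΛ) (B k) * (hubbardTTPrimeFermionInteraction 0 1 0).localHamiltonian Λ') := by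
  rw [localHamiltonian_tPrime_split c U Λ', Finset.smul_sum, ← Finset.sum_add_distrib]
  refine Finset.sum_congr rfl fun k _ => ?_
  simp only [add_mul, mul_add, smul_mul_assoc, mul_smul_comm, smul_sub]
  abel

/-- The equation-of-motion family is ONE commutator: `Σ_k [H, ΓB_k] = [H, Γ(Σ_k B_k)]`. [folklore] -/
theorem eom_sum_eq_commutator_sum (H : FermionOp Λ') (hΛ : Λ ⊆ Λ') {κ' : Type*} (s : Finset κ') (B : κ' → FermionOp Λ) :
    ∑ k ∈ s, (H * fermionEmbed (PolySite.incl hΛ) (B k) - fermionEmbed (PolySite.incl hΛ) (B k) * H) =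
      H * fermionEmbed (PolySite.incl hΛ) (∑ k ∈ s, B k) - fermionEmbed (PolySite.incl hΛ) (∑ k ∈ s, B k) * H := by
  rw [map_sum, Finset.mul_sum, Finset.sum_mul, ← Finset.sum_sub_distrib]

end Split
/-! ## §2  The rotated local functionals: linearity and the two dictionary values -/

section Functionals

variable {Λ' : Finset (Site 2)}

/-- `Re (ω∘g)_{Λ'}(T₁ − T₂) = Re (ω∘g)_{Λ'}(T₁) − Re (ω∘g)_{Λ'}(T₂)`. [folklore] -/
theorem re_d4_expect_sub (ω : InfVolFermionState 2) (g : DihedralGroup 4) (T₁ T₂ : FermionOp Λ') :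
    (ω.expect (d4ShiftSet g 0 Λ') (fermionEmbed (PolySite.d4Emb g 0 Λ') (T₁ - T₂))).re =
      (ω.expect (d4ShiftSet g 0 Λ') (fermionEmbed (PolySite.d4Emb g 0 Λ') T₁)).re -
        (ω.expect (d4ShiftSet g 0 Λ') (fermionEmbed (PolySite.d4Emb g 0 Λ') T₂)).re := by
  rw [map_sub, map_sub, Complex.sub_re]

/-- `Re (ω∘g)_{Λ'}(r·T) = r·Re (ω∘g)_{Λ'}(T)` for real `r`. [folklore] -/
theorem re_d4_expect_smul (ω : InfVolFermionState 2) (g : DihedralGroup 4) (r : ℝ) (T : FermionOp Λ') :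
    (ω.expect (d4ShiftSet g 0 Λ') (fermionEmbed (PolySite.d4Emb g 0 Λ') (((r : ℝ) : ℂ) • T))).re =
      r * (ω.expect (d4ShiftSet g 0 Λ') (fermionEmbed (PolySite.d4Emb g 0 Λ') T)).re := by
  rw [map_smul, map_smul, smul_eq_mul, Complex.re_ofReal_mul]

/-- `Re (ω∘g)_{Λ'}(r·1) = r`. [folklore] -/
theorem re_d4_expect_smul_one (ω : InfVolFermionState 2) (g : DihedralGroup 4) (r : ℝ) :
    (ω.expect (d4ShiftSet g 0 Λ') (fermionEmbed (PolySite.d4Emb g 0 Λ') (((r : ℝ) : ℂ) • (1 : FermionOp Λ')))).re = r := by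
  rw [re_d4_expect_smul, map_one, ω.expect_one, Complex.one_re, mul_one]

/-- `Re (ω∘g)_{Λ'}(T₁ + T₂) = Re (ω∘g)_{Λ'}(T₁) + Re (ω∘g)_{Λ'}(T₂)`. [folklore] -/
theorem re_d4_expect_add (ω : InfVolFermionState 2) (g : DihedralGroup 4) (T₁ T₂ : FermionOp Λ') :
    (ω.expect (d4ShiftSet g 0 Λ') (fermionEmbed (PolySite.d4Emb g 0 Λ') (T₁ + T₂))).re =
      (ω.expect (d4ShiftSet g 0 Λ') (fermionEmbed (PolySite.d4Emb g 0 Λ') T₁)).re +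
        (ω.expect (d4ShiftSet g 0 Λ') (fermionEmbed (PolySite.d4Emb g 0 Λ') T₂)).re := by
  rw [map_add, map_add, Complex.add_re]

end Functionals

/-! ## §3  ONE VERTEX: a window identity issued at hopping `sv`, read in a torus-limit ground state at hopping `s` -/

section Vertex

/-- **(V) — one pinned vertex.** A `t–t'` window identity in `𝔄_{Λ'}` issued at hopping `sv` (objective `Xv`, constant `c`, density rows
`μ_σ, ν`, a CAP row `κ (cap·1 − ΓE_Φ^{(1,sv,U)})` and a CUT row `κ' (ΓE_Φ^{(1,sv,U)} − fl·1)`, Gram / eom / affine-`D₄` / charged /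
anti-Hermitian / residual families in the tree's `hcert` shape), read in a torus limit `ω` of unit sector ground states AT HOPPING `s`
(`U ≥ 0`, density `0 ≤ n < 2`), gives
`(c − Σ‖a‖ + (Σμ)(n/2 − ν)) + κ (cap − e + (s − sv) K₂ω) + κ' (e − (s − sv) K₂ω − fl) + (E₀ω + sv·E₁ω) ≤ |S|⁻¹ Σ_γ Re (ω∘γ)_{Λ'}(Xv)`,
`e = e₀(1,s,U,n)`, `K₂ω = e_{Φ(0,1,0)}(ω)`, `E₀ω = |S|⁻¹Σ_γ Re (ω∘γ)(Σ_k[H^{(1,0,U)}_{Λ'}, ΓB_k])`, `E₁ω` = the same with `T′_{Λ'}` (module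
docstring §3 for the proof). [cite: WangEtAl2024, §III] [cite: Bertsekas1999NonlinearProgramming, Prop. 5.1.3] -/
theorem pinnedVertexRow_of_windowIdentity
    {U : ℝ} (hU : 0 ≤ U) {n : ℝ} (hn0 : 0 ≤ n) (hn2 : n < 2) (sv s : ℝ)
    {Λ Λ' : Finset (Site 2)} (hΛ : Λ ⊆ Λ') (h8 : thicken Λ 1 ⊆ Λ')
    (h0 : thicken ({0} : Finset (Site 2)) 1 ⊆ Λ') (hz : (0 : Site 2) ∈ Λ')
    {S : Finset (DihedralGroup 4)} (h1 : (1 : DihedralGroup 4) ∈ S) (hmul : ∀ a ∈ S, ∀ b ∈ S, a * b ∈ S)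
    (Xv : FermionOp Λ') (μ : Fin 2 → ℝ) (ν : ℝ) (cap fl κ κ' : ℚ)
    {m : Type*} [Fintype m] [DecidableEq m] {Λm : Matrix m m ℂ} (hΛm : Λm.PosSemidef) (O : m → FermionOp Λ')
    {κι : Type*} (se : Finset κι) (B : κι → FermionOp Λ)
    {ι : Type*} (tt : Finset ι) (γ : ι → DihedralGroup 4) (hγS : ∀ l ∈ tt, γ l ∈ S) (wv : ι → Site 2)
    (hsh : ∀ l, d4ShiftSet (γ l) (wv l) Λ ⊆ Λ') (Y : ι → FermionOp Λ)
    {ρ : Type*} (uu : Finset ρ) (b : ρ → ℂ) (cw : ρ → List (Orb (PolySite Λ') × Bool))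
    (hcw : ∀ j ∈ uu, ladderCharge (cw j) ≠ 0 ∨ ladderSpinCharge (cw j) ≠ 0)
    {δ : Type*} (ah : Finset δ) (dc : δ → ℝ) (V : δ → FermionOp Λ')
    {κ'' : Type*} (w : Finset κ'') (a : κ'' → ℂ) (word : κ'' → List (Orb (PolySite Λ') × Bool)) {c : ℝ}
    (hcert : Xv - (c : ℂ) • (1 : FermionOp Λ') -
        ∑ σ : Fin 2, ((μ σ : ℝ) : ℂ) • (nAt 0 hz σ - ((ν : ℝ) : ℂ) • (1 : FermionOp Λ')) -
        (((κ : ℚ) : ℝ) : ℂ) • ((((cap : ℚ) : ℝ) : ℂ) • (1 : FermionOp Λ') -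
          fermionEmbed (PolySite.incl h0) ((hubbardTTPrimeFermionInteraction 1 sv U).meanEnergyObs 1)) -
        (((κ' : ℚ) : ℝ) : ℂ) • (fermionEmbed (PolySite.incl h0) ((hubbardTTPrimeFermionInteraction 1 sv U).meanEnergyObs 1) -
          (((fl : ℚ) : ℝ) : ℂ) • (1 : FermionOp Λ')) =
      gramForm Λm O +
        (∑ k ∈ se, ((hubbardTTPrimeFermionInteraction 1 sv U).localHamiltonian Λ' * fermionEmbed (PolySite.incl hΛ) (B k) -
            fermionEmbed (PolySite.incl hΛ) (B k) * (hubbardTTPrimeFermionInteraction 1 sv U).localHamiltonian Λ') +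
          ∑ l ∈ tt, (fermionEmbed (PolySite.incl (hsh l)) (fermionEmbed (PolySite.d4Emb (γ l) (wv l) Λ) (Y l)) -
            fermionEmbed (PolySite.incl hΛ) (Y l)) +
          ∑ j ∈ uu, b j • ladderWord (cw j)) +
        (∑ m' ∈ ah, ((dc m' : ℝ) : ℂ) • ((V m')ᴴ - V m') + ∑ k ∈ w, a k • ladderWord (word k)))
    {Ls : ℕ → ℕ} (hLs : Tendsto Ls atTop atTop)
    {ψ : ∀ L, Fock (Orb (FermionTorus 2 L))}
    (hψ : ∀ j, IsGroundStateInSector (hubbardTorusTT' (Ls j) 1 s U) (rectN n (Ls j)) 0 (ψ (Ls j)))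
    (hψ1 : ∀ j, star (ψ (Ls j)) ⬝ᵥ ψ (Ls j) = 1)
    {ω : InfVolFermionState 2} (hω : ω.IsTorusLimitOf ψ Ls) :
    (c - ∑ k ∈ w, ‖a k‖ + (∑ σ : Fin 2, μ σ) * (n / 2 - ν)) +
      ((κ : ℚ) : ℝ) * (((cap : ℚ) : ℝ) - energyDensityTT' 1 s U n +
        (s - sv) * ω.meanEnergy (hubbardTTPrimeFermionInteraction 0 1 0) 1) +
      ((κ' : ℚ) : ℝ) * (energyDensityTT' 1 s U n -
        (s - sv) * ω.meanEnergy (hubbardTTPrimeFermionInteraction 0 1 0) 1 - ((fl : ℚ) : ℝ)) +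
      ((S.card : ℝ)⁻¹ * ∑ g ∈ S, (ω.expect (d4ShiftSet g 0 Λ') (fermionEmbed (PolySite.d4Emb g 0 Λ')
          (∑ k ∈ se, ((hubbardTTPrimeFermionInteraction 1 0 U).localHamiltonian Λ' * fermionEmbed (PolySite.incl hΛ) (B k) -
            fermionEmbed (PolySite.incl hΛ) (B k) * (hubbardTTPrimeFermionInteraction 1 0 U).localHamiltonian Λ')))).re +
        sv * ((S.card : ℝ)⁻¹ * ∑ g ∈ S, (ω.expect (d4ShiftSet g 0 Λ') (fermionEmbed (PolySite.d4Emb g 0 Λ')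
          (∑ k ∈ se, ((hubbardTTPrimeFermionInteraction 0 1 0).localHamiltonian Λ' * fermionEmbed (PolySite.incl hΛ) (B k) -
            fermionEmbed (PolySite.incl hΛ) (B k) * (hubbardTTPrimeFermionInteraction 0 1 0).localHamiltonian Λ')))).re)) ≤
      (S.card : ℝ)⁻¹ * ∑ g ∈ S, (ω.expect (d4ShiftSet g 0 Λ') (fermionEmbed (PolySite.d4Emb g 0 Λ') Xv)).re := by
  haveI : Nonempty ↥S := ⟨⟨1, h1⟩⟩
  have hS : (S.card : ℝ) ≠ 0 := by exact_mod_cast (Finset.card_pos.2 ⟨1, h1⟩).ne'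
  -- names
  set Hv : FermionOp Λ' := (hubbardTTPrimeFermionInteraction 1 sv U).localHamiltonian Λ' with hHv
  set H₀ : FermionOp Λ' := (hubbardTTPrimeFermionInteraction 1 0 U).localHamiltonian Λ' with hH₀
  set T' : FermionOp Λ' := (hubbardTTPrimeFermionInteraction 0 1 0).localHamiltonian Λ' with hT'
  set Ev : FermionOp Λ' := fermionEmbed (PolySite.incl h0) ((hubbardTTPrimeFermionInteraction 1 sv U).meanEnergyObs 1) with hEv
  set EOM : FermionOp Λ' := ∑ k ∈ se, (Hv * fermionEmbed (PolySite.incl hΛ) (B k) - fermionEmbed (PolySite.incl hΛ) (B k) * Hv)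
    with hEOM
  set EOM₀ : FermionOp Λ' := ∑ k ∈ se, (H₀ * fermionEmbed (PolySite.incl hΛ) (B k) - fermionEmbed (PolySite.incl hΛ) (B k) * H₀)
    with hEOM₀
  set EOM₁ : FermionOp Λ' := ∑ k ∈ se, (T' * fermionEmbed (PolySite.incl hΛ) (B k) - fermionEmbed (PolySite.incl hΛ) (B k) * T')
    with hEOM₁
  set KE : FermionOp Λ' := (((κ : ℚ) : ℝ) : ℂ) • ((((cap : ℚ) : ℝ) : ℂ) • (1 : FermionOp Λ') - Ev) +
    (((κ' : ℚ) : ℝ) : ℂ) • (Ev - (((fl : ℚ) : ℝ) : ℂ) • (1 : FermionOp Λ')) with hKE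
  set Xt : FermionOp Λ' := Xv - KE - EOM with hXt
  set e : ℝ := energyDensityTT' 1 s U n with he
  set K₂ : ℝ := ω.meanEnergy (hubbardTTPrimeFermionInteraction 0 1 0) 1 with hK₂
  -- (1) the identity, rearranged: objective `Xt`, `κ := 0`, EMPTY eom family
  have hcert' : Xt - (c : ℂ) • (1 : FermionOp Λ') -
      ∑ σ : Fin 2, ((μ σ : ℝ) : ℂ) • (nAt 0 hz σ - ((ν : ℝ) : ℂ) • (1 : FermionOp Λ')) -
      (((0 : ℝ) : ℝ) : ℂ) • ((((e : ℝ) : ℝ) : ℂ) • (1 : FermionOp Λ') -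
        fermionEmbed (PolySite.incl h0) ((hubbardTTPrimeFermionInteraction 1 s U).meanEnergyObs 1)) =
      gramForm Λm O +
        (∑ k ∈ (∅ : Finset κι), ((hubbardTTPrimeFermionInteraction 1 s U).localHamiltonian Λ' * fermionEmbed (PolySite.incl hΛ) (B k) -
            fermionEmbed (PolySite.incl hΛ) (B k) * (hubbardTTPrimeFermionInteraction 1 s U).localHamiltonian Λ') +
          ∑ l ∈ tt, (fermionEmbed (PolySite.incl (hsh l)) (fermionEmbed (PolySite.d4Emb (γ l) (wv l) Λ) (Y l)) -
            fermionEmbed (PolySite.incl hΛ) (Y l)) +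
          ∑ j ∈ uu, b j • ladderWord (cw j)) +
        (∑ m' ∈ ah, ((dc m' : ℝ) : ℂ) • ((V m')ᴴ - V m') + ∑ k ∈ w, a k • ladderWord (word k)) := by
    rw [Complex.ofReal_zero, zero_smul, sub_zero, Finset.sum_empty, zero_add]
    have ee : Xt - (c : ℂ) • (1 : FermionOp Λ') -
        ∑ σ : Fin 2, ((μ σ : ℝ) : ℂ) • (nAt 0 hz σ - ((ν : ℝ) : ℂ) • (1 : FermionOp Λ')) =
        (Xv - (c : ℂ) • (1 : FermionOp Λ') -
          ∑ σ : Fin 2, ((μ σ : ℝ) : ℂ) • (nAt 0 hz σ - ((ν : ℝ) : ℂ) • (1 : FermionOp Λ')) -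
          (((κ : ℚ) : ℝ) : ℂ) • ((((cap : ℚ) : ℝ) : ℂ) • (1 : FermionOp Λ') - Ev) -
          (((κ' : ℚ) : ℝ) : ℂ) • (Ev - (((fl : ℚ) : ℝ) : ℂ) • (1 : FermionOp Λ'))) - EOM := by
      rw [hXt, hKE]; abel
    rw [ee, hcert, hEOM]
    abel
  -- (2) the tree's soundness theorem at the state's hopping `s`
  have hmain := hω.re_sum_expect_d4_ge_of_window_certificate_TT'_ineq 1 s hU hn0 hn2 (κ := 0) (u := e) le_rfl le_rfl
    hΛ h8 h0 hz h1 hmul Xt μ ν hΛm O ∅ B tt γ hγS wv hsh Y uu b cw hcw ah dc V w a word hcert' hLs hψ hψ1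
  -- (3) the dictionary values
  have hMv : ∀ g : DihedralGroup 4,
      (ω.expect (d4ShiftSet g 0 Λ') (fermionEmbed (PolySite.d4Emb g 0 Λ') Ev)).re = e + (sv - s) * K₂ := by
    intro g
    rw [hEv, hω.re_expect_d4Emb_meanEnergyObs 1 sv U g h0 hLs, ω.meanEnergy_hubbardTTPrime_affine 1 s U sv U,
      hω.meanEnergy_hubbardTTPrime_eq_energyDensityTT' 1 s hU hn0 hn2 hLs hψ hψ1, sub_self, zero_mul, add_zero]
  have hEOMsplit : EOM = EOM₀ + ((sv : ℝ) : ℂ) • EOM₁ := by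
    rw [hEOM, hEOM₀, hEOM₁, hHv, hH₀, hT']
    exact eom_tPrime_split sv U hΛ se B
  -- (4) expand the objective in each rotated functional
  have hexp : ∀ g : DihedralGroup 4,
      (ω.expect (d4ShiftSet g 0 Λ') (fermionEmbed (PolySite.d4Emb g 0 Λ') Xt)).re =
        (ω.expect (d4ShiftSet g 0 Λ') (fermionEmbed (PolySite.d4Emb g 0 Λ') Xv)).re -
          (((κ : ℚ) : ℝ) * (((cap : ℚ) : ℝ) - (e + (sv - s) * K₂)) + ((κ' : ℚ) : ℝ) * ((e + (sv - s) * K₂) - ((fl : ℚ) : ℝ))) -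
          (ω.expect (d4ShiftSet g 0 Λ') (fermionEmbed (PolySite.d4Emb g 0 Λ') EOM₀)).re -
          sv * (ω.expect (d4ShiftSet g 0 Λ') (fermionEmbed (PolySite.d4Emb g 0 Λ') EOM₁)).re := by
    intro g
    rw [hXt, hEOMsplit, re_d4_expect_sub, re_d4_expect_sub, re_d4_expect_add ω g EOM₀, re_d4_expect_smul, hKE,
      re_d4_expect_add, re_d4_expect_smul, re_d4_expect_smul, re_d4_expect_sub, re_d4_expect_sub, re_d4_expect_smul_one,
      re_d4_expect_smul_one, hMv g]
    ring
  -- (5) sum over the orbit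
  have hsum : (S.card : ℝ)⁻¹ * ∑ g ∈ S, (ω.expect (d4ShiftSet g 0 Λ') (fermionEmbed (PolySite.d4Emb g 0 Λ') Xt)).re =
      (S.card : ℝ)⁻¹ * ∑ g ∈ S, (ω.expect (d4ShiftSet g 0 Λ') (fermionEmbed (PolySite.d4Emb g 0 Λ') Xv)).re -
        (((κ : ℚ) : ℝ) * (((cap : ℚ) : ℝ) - (e + (sv - s) * K₂)) + ((κ' : ℚ) : ℝ) * ((e + (sv - s) * K₂) - ((fl : ℚ) : ℝ))) -
        (S.card : ℝ)⁻¹ * ∑ g ∈ S, (ω.expect (d4ShiftSet g 0 Λ') (fermionEmbed (PolySite.d4Emb g 0 Λ') EOM₀)).re -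
        sv * ((S.card : ℝ)⁻¹ * ∑ g ∈ S, (ω.expect (d4ShiftSet g 0 Λ') (fermionEmbed (PolySite.d4Emb g 0 Λ') EOM₁)).re) := by
    rw [Finset.sum_congr rfl fun g _ => hexp g, Finset.sum_sub_distrib, Finset.sum_sub_distrib, Finset.sum_sub_distrib,
      Finset.sum_const, nsmul_eq_mul, ← Finset.mul_sum]
    field_simp
  rw [hsum] at hmain
  linarith

end Vertex

/-! ## §4  (E): the shared equation-of-motion functional vanishes at the state's own hopping -/

section Stationarity

/-- **(E) — stationarity of the SHARED eom functional.** With `E₀ω := |S|⁻¹Σ_γ Re (ω∘γ)_{Λ'}(Σ_k [H^{(1,0,U)}_{Λ'}, ΓB_k])` and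
`E₁ω := |S|⁻¹Σ_γ Re (ω∘γ)_{Λ'}(Σ_k [T′_{Λ'}, ΓB_k])`, every torus limit `ω` of unit sector ground states at hopping `s` has
`E₀ω + s·E₁ω = 0`: the sum is the orbit mean of `Re ω(Σ_k [H^{(1,s,U)}_{Λ'}, ΓB_k]) = Re ω([H^{(1,s,U)}_{Λ'}, Γ(Σ_k B_k)])`, which vanishes by the
tree's stationarity row `CARPolyWindow.orbitMean_re_commutator_eq_zero`. [cite: Han2020Bootstrap, §3] -/
theorem pinnedStationarity {U : ℝ} (hU : 0 ≤ U) {n : ℝ} (hn0 : 0 ≤ n) (hn2 : n < 2) (s : ℝ)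
    {Λ Λ' : Finset (Site 2)} (hΛ : Λ ⊆ Λ') (h8 : thicken Λ 1 ⊆ Λ')
    (h0 : thicken ({0} : Finset (Site 2)) 1 ⊆ Λ') (hz : (0 : Site 2) ∈ Λ')
    {S : Finset (DihedralGroup 4)} (h1 : (1 : DihedralGroup 4) ∈ S) (hmul : ∀ a ∈ S, ∀ b ∈ S, a * b ∈ S)
    {κι : Type*} (se : Finset κι) (B : κι → FermionOp Λ)
    {Ls : ℕ → ℕ} (hLs : Tendsto Ls atTop atTop) {ψ : ∀ L, Fock (Orb (FermionTorus 2 L))}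
    (hψ : ∀ j, IsGroundStateInSector (hubbardTorusTT' (Ls j) 1 s U) (rectN n (Ls j)) 0 (ψ (Ls j)))
    (hψ1 : ∀ j, star (ψ (Ls j)) ⬝ᵥ ψ (Ls j) = 1) {ω : InfVolFermionState 2} (hω : ω.IsTorusLimitOf ψ Ls) :
    (S.card : ℝ)⁻¹ * ∑ g ∈ S, (ω.expect (d4ShiftSet g 0 Λ') (fermionEmbed (PolySite.d4Emb g 0 Λ')
        (∑ k ∈ se, ((hubbardTTPrimeFermionInteraction 1 0 U).localHamiltonian Λ' * fermionEmbed (PolySite.incl hΛ) (B k) -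
          fermionEmbed (PolySite.incl hΛ) (B k) * (hubbardTTPrimeFermionInteraction 1 0 U).localHamiltonian Λ')))).re +
      s * ((S.card : ℝ)⁻¹ * ∑ g ∈ S, (ω.expect (d4ShiftSet g 0 Λ') (fermionEmbed (PolySite.d4Emb g 0 Λ')
        (∑ k ∈ se, ((hubbardTTPrimeFermionInteraction 0 1 0).localHamiltonian Λ' * fermionEmbed (PolySite.incl hΛ) (B k) -
          fermionEmbed (PolySite.incl hΛ) (B k) * (hubbardTTPrimeFermionInteraction 0 1 0).localHamiltonian Λ')))).re) = 0 := by
  have hz0 := CARPolyWindow.orbitMean_re_commutator_eq_zero s hU hn0 hn2 hΛ h8 h0 hz h1 hmul (∑ k ∈ se, B k) hLs hψ hψ1 hω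
  rw [← eom_sum_eq_commutator_sum _ hΛ se B, eom_tPrime_split s U hΛ se B] at hz0
  simp_rw [re_d4_expect_add, re_d4_expect_smul] at hz0
  rw [Finset.sum_add_distrib, ← Finset.mul_sum] at hz0
  linear_combination hz0

end Stationarity

/-! ## §5  TWO window identities with SHARED eom words ⇒ the pinned t′-pair shape -/

section Pair

/-- **PINNED t′-PAIR SHAPE FROM TWO WINDOW IDENTITIES.** Square lattice, `t = 1`, `0 ≤ U`, density `0 ≤ n < 2`; window `Λ ⊆ Λ₇ = box 2 7`
with `thicken Λ 1 ⊆ Λ₇`; SHARED equation-of-motion words `B_k ∈ 𝔄_Λ` (`k ∈ se`); an objective family `X : ℝ → 𝔄_{Λ₇}`. For each vertex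
`v ∈ {A, B}` ONE window identity in `𝔄_{Λ₇}` in the tree's `hcert` shape ISSUED AT HOPPING `s_v` with objective `X s_v`, constant `c_v`,
density rows `(μ_v, ν_v)`, a cap row `κ_v (cap_v·1 − ΓE_Φ^{(1,s_v,U)})`, a cut row `κ_v′ (ΓE_Φ^{(1,s_v,U)} − fl_v·1)`, Gram data
`(Λm_v ⪰ 0, O_v)`, the eom family `Σ_{k∈se} [H^{(1,s_v,U)}_{Λ₇}, ΓB_k]` ON THE SHARED WORDS, affine-`D₄` / charged / anti-Hermitian /
residual families. Then for all rational `β_v ≤ c_v − Σ‖a_v‖ + (Σ_σ μ_vσ)(n/2 − ν_v)`: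
`SquareTTPrimePinnedPairRowT U n sA sB capA capB flA flB βA κA κA′ βB κB κB′ X` — with the witnesses
`E₀ω = |D₄|⁻¹Σ_γ Re (ω∘γ)(Σ_k [H^{(1,0,U)}_{Λ₇}, ΓB_k])`, `E₁ω = |D₄|⁻¹Σ_γ Re (ω∘γ)(Σ_k [T′_{Λ₇}, ΓB_k])`: (E) is `pinnedStationarity`,
(V_A)/(V_B) are `pinnedVertexRow_of_windowIdentity`. This is the typed passage «two vertex certificates solved with pinned (shared) eom
multipliers ⇒ the pair claim node‴» — no sign condition on the `κ`'s is needed for the shape itself (the bundle law `…bundleExt` asks for them).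
[cite: Bertsekas1999NonlinearProgramming, Prop. 5.1.3] [cite: BoydVandenberghe2004, §5.9] [cite: WangEtAl2024, §III] -/
theorem SquareTTPrimePinnedPairRowT.of_windowIdentities
    {U : ℝ} (hU : 0 ≤ U) {n : ℝ} (hn0 : 0 ≤ n) (hn2 : n < 2) (sA sB : ℝ)
    {Λ : Finset (Site 2)} (hΛ : Λ ⊆ box 2 7) (h8 : thicken Λ 1 ⊆ box 2 7)
    (h0 : thicken ({0} : Finset (Site 2)) 1 ⊆ box 2 7) (hz : (0 : Site 2) ∈ box 2 7)
    (X : ℝ → FermionOp (box 2 7))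
    {κι : Type*} (se : Finset κι) (B : κι → FermionOp Λ)
    -- vertex A
    (μA : Fin 2 → ℝ) (νA : ℝ) (capA flA κA κA' : ℚ)
    {mA : Type*} [Fintype mA] [DecidableEq mA] {ΛmA : Matrix mA mA ℂ} (hΛmA : ΛmA.PosSemidef) (OA : mA → FermionOp (box 2 7))
    {ιA : Type*} (ttA : Finset ιA) (γA : ιA → DihedralGroup 4) (wvA : ιA → Site 2) (hshA : ∀ l, d4ShiftSet (γA l) (wvA l) Λ ⊆ box 2 7)
    (YA : ιA → FermionOp Λ)
    {ρA : Type*} (uuA : Finset ρA) (bA : ρA → ℂ) (cwA : ρA → List (Orb (PolySite (box 2 7)) × Bool))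
    (hcwA : ∀ j ∈ uuA, ladderCharge (cwA j) ≠ 0 ∨ ladderSpinCharge (cwA j) ≠ 0)
    {δA : Type*} (ahA : Finset δA) (dcA : δA → ℝ) (VA : δA → FermionOp (box 2 7))
    {κ''A : Type*} (wA : Finset κ''A) (aA : κ''A → ℂ) (wordA : κ''A → List (Orb (PolySite (box 2 7)) × Bool))
    {cA0 : ℝ}
    (hcertA : X sA - (cA0 : ℂ) • (1 : FermionOp (box 2 7)) -
        ∑ σ : Fin 2, ((μA σ : ℝ) : ℂ) • (nAt 0 hz σ - ((νA : ℝ) : ℂ) • (1 : FermionOp (box 2 7))) -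
        (((κA : ℚ) : ℝ) : ℂ) • ((((capA : ℚ) : ℝ) : ℂ) • (1 : FermionOp (box 2 7)) -
          fermionEmbed (PolySite.incl h0) ((hubbardTTPrimeFermionInteraction 1 sA U).meanEnergyObs 1)) -
        (((κA' : ℚ) : ℝ) : ℂ) • (fermionEmbed (PolySite.incl h0) ((hubbardTTPrimeFermionInteraction 1 sA U).meanEnergyObs 1) -
          (((flA : ℚ) : ℝ) : ℂ) • (1 : FermionOp (box 2 7))) =
      gramForm ΛmA OA +
        (∑ k ∈ se, ((hubbardTTPrimeFermionInteraction 1 sA U).localHamiltonian (box 2 7) * fermionEmbed (PolySite.incl hΛ) (B k) -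
            fermionEmbed (PolySite.incl hΛ) (B k) * (hubbardTTPrimeFermionInteraction 1 sA U).localHamiltonian (box 2 7)) +
          ∑ l ∈ ttA, (fermionEmbed (PolySite.incl (hshA l)) (fermionEmbed (PolySite.d4Emb (γA l) (wvA l) Λ) (YA l)) -
            fermionEmbed (PolySite.incl hΛ) (YA l)) +
          ∑ j ∈ uuA, bA j • ladderWord (cwA j)) +
        (∑ m' ∈ ahA, ((dcA m' : ℝ) : ℂ) • ((VA m')ᴴ - VA m') + ∑ k ∈ wA, aA k • ladderWord (wordA k)))
    {βA : ℚ} (hβA : ((βA : ℚ) : ℝ) ≤ cA0 - ∑ k ∈ wA, ‖aA k‖ + (∑ σ : Fin 2, μA σ) * (n / 2 - νA))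
    -- vertex B
    (μB : Fin 2 → ℝ) (νB : ℝ) (capB flB κB κB' : ℚ)
    {mB : Type*} [Fintype mB] [DecidableEq mB] {ΛmB : Matrix mB mB ℂ} (hΛmB : ΛmB.PosSemidef) (OB : mB → FermionOp (box 2 7))
    {ιB : Type*} (ttB : Finset ιB) (γB : ιB → DihedralGroup 4) (wvB : ιB → Site 2) (hshB : ∀ l, d4ShiftSet (γB l) (wvB l) Λ ⊆ box 2 7)
    (YB : ιB → FermionOp Λ)
    {ρB : Type*} (uuB : Finset ρB) (bB : ρB → ℂ) (cwB : ρB → List (Orb (PolySite (box 2 7)) × Bool))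
    (hcwB : ∀ j ∈ uuB, ladderCharge (cwB j) ≠ 0 ∨ ladderSpinCharge (cwB j) ≠ 0)
    {δB : Type*} (ahB : Finset δB) (dcB : δB → ℝ) (VB : δB → FermionOp (box 2 7))
    {κ''B : Type*} (wB : Finset κ''B) (aB : κ''B → ℂ) (wordB : κ''B → List (Orb (PolySite (box 2 7)) × Bool))
    {cB0 : ℝ}
    (hcertB : X sB - (cB0 : ℂ) • (1 : FermionOp (box 2 7)) -
        ∑ σ : Fin 2, ((μB σ : ℝ) : ℂ) • (nAt 0 hz σ - ((νB : ℝ) : ℂ) • (1 : FermionOp (box 2 7))) -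
        (((κB : ℚ) : ℝ) : ℂ) • ((((capB : ℚ) : ℝ) : ℂ) • (1 : FermionOp (box 2 7)) -
          fermionEmbed (PolySite.incl h0) ((hubbardTTPrimeFermionInteraction 1 sB U).meanEnergyObs 1)) -
        (((κB' : ℚ) : ℝ) : ℂ) • (fermionEmbed (PolySite.incl h0) ((hubbardTTPrimeFermionInteraction 1 sB U).meanEnergyObs 1) -
          (((flB : ℚ) : ℝ) : ℂ) • (1 : FermionOp (box 2 7))) =
      gramForm ΛmB OB +
        (∑ k ∈ se, ((hubbardTTPrimeFermionInteraction 1 sB U).localHamiltonian (box 2 7) * fermionEmbed (PolySite.incl hΛ) (B k) -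
            fermionEmbed (PolySite.incl hΛ) (B k) * (hubbardTTPrimeFermionInteraction 1 sB U).localHamiltonian (box 2 7)) +
          ∑ l ∈ ttB, (fermionEmbed (PolySite.incl (hshB l)) (fermionEmbed (PolySite.d4Emb (γB l) (wvB l) Λ) (YB l)) -
            fermionEmbed (PolySite.incl hΛ) (YB l)) +
          ∑ j ∈ uuB, bB j • ladderWord (cwB j)) +
        (∑ m' ∈ ahB, ((dcB m' : ℝ) : ℂ) • ((VB m')ᴴ - VB m') + ∑ k ∈ wB, aB k • ladderWord (wordB k)))
    {βB : ℚ} (hβB : ((βB : ℚ) : ℝ) ≤ cB0 - ∑ k ∈ wB, ‖aB k‖ + (∑ σ : Fin 2, μB σ) * (n / 2 - νB)) :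
    SquareTTPrimePinnedPairRowT U n sA sB capA capB flA flB βA κA κA' βB κB κB' X := by
  have h1 : (1 : DihedralGroup 4) ∈ (Finset.univ : Finset (DihedralGroup 4)) := Finset.mem_univ _
  have hmul : ∀ a ∈ (Finset.univ : Finset (DihedralGroup 4)), ∀ b ∈ (Finset.univ : Finset (DihedralGroup 4)),
      a * b ∈ (Finset.univ : Finset (DihedralGroup 4)) := fun _ _ _ _ => Finset.mem_univ _
  refine ⟨fun ω => ((Finset.univ : Finset (DihedralGroup 4)).card : ℝ)⁻¹ * ∑ g ∈ (Finset.univ : Finset (DihedralGroup 4)),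
      (ω.expect (d4ShiftSet g 0 (box 2 7)) (fermionEmbed (PolySite.d4Emb g 0 (box 2 7))
          (∑ k ∈ se, ((hubbardTTPrimeFermionInteraction 1 0 U).localHamiltonian (box 2 7) * fermionEmbed (PolySite.incl hΛ) (B k) -
            fermionEmbed (PolySite.incl hΛ) (B k) * (hubbardTTPrimeFermionInteraction 1 0 U).localHamiltonian (box 2 7))))).re,
    fun ω => ((Finset.univ : Finset (DihedralGroup 4)).card : ℝ)⁻¹ * ∑ g ∈ (Finset.univ : Finset (DihedralGroup 4)),
      (ω.expect (d4ShiftSet g 0 (box 2 7)) (fermionEmbed (PolySite.d4Emb g 0 (box 2 7))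
          (∑ k ∈ se, ((hubbardTTPrimeFermionInteraction 0 1 0).localHamiltonian (box 2 7) * fermionEmbed (PolySite.incl hΛ) (B k) -
            fermionEmbed (PolySite.incl hΛ) (B k) * (hubbardTTPrimeFermionInteraction 0 1 0).localHamiltonian (box 2 7))))).re,
    fun s _ ω Ls ψ hLs hψ hψ1 hω => ⟨?_, ?_, ?_⟩⟩
  · exact pinnedStationarity hU hn0 hn2 s hΛ h8 h0 hz h1 hmul se B hLs hψ hψ1 hω
  · have h := pinnedVertexRow_of_windowIdentity hU hn0 hn2 sA s hΛ h8 h0 hz h1 hmul (X sA) μA νA capA flA κA κA' hΛmA OA se B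
      ttA γA (fun l _ => Finset.mem_univ _) wvA hshA YA uuA bA cwA hcwA ahA dcA VA wA aA wordA hcertA hLs hψ hψ1 hω
    unfold tPrimeObjOrbitMean
    linarith
  · have h := pinnedVertexRow_of_windowIdentity hU hn0 hn2 sB s hΛ h8 h0 hz h1 hmul (X sB) μB νB capB flB κB κB' hΛmB OB se B
      ttB γB (fun l _ => Finset.mem_univ _) wvB hshB YB uuB bB cwB hcwB ahB dcB VB wB aB wordB hcertB hLs hψ hψ1 hω
    unfold tPrimeObjOrbitMean
    linarith

end Pair

end Summit.Ventures.CertifiedManyBodySolver.Downfold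

end
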